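import Literature.AlgebraicGeometry.Smoothening.SmoothSpecialFibreResiduePoints
import Literature.NumberTheory.EllipticCurves.NeronModelCodimOne
import Literature.AlgebraicGeometry.Motives.ZariskiChowCover
import Mathlib.AlgebraicGeometry.SpreadingOut
import Mathlib.AlgebraicGeometry.Morphisms.Separated
import Mathlib.AlgebraicGeometry.Morphisms.Smooth
import HarnessLib

/-!
# The Néron mapping property from the extension property for points: definedness in
# codimension one

Topic: `Literature/AlgebraicGeometry/Smoothening` (Bosch–Lütkebohmert–Raynaud, *Néron Models*,
§3.5–3.6 and Thm. 7.1/1; M. Artin, *Néron Models*, Cor. (1.6) and §3: a smooth separated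
`R`-group scheme of finite type `G` whose points with values in the discrete valuation rings
"of ramification index `1`" over `R` all extend is a Néron model of its generic fibre — the
mapping property for a smooth `Z` follows from Weil's extension theorem once the rational map
`Z ⇢ G` is known to be defined at the generic points of the special fibre of `Z`, whose local
rings are such discrete valuation rings). This file proves that input of Weil's theorem
(`Literature.NumberTheory.EllipticCurves.weil_extension_of_codimOne`, hypothesis `h1`):

* `specMap_algebraMap_stalk_eq` — bookkeeping: for an affine `X → Spec R` the composite
  `Spec 𝒪_{X,x} → X → Spec R` is `Spec` of `R → Γ(X) → 𝒪_{X,x}`;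
* `irreducible_stalkHom`, `index_one_stalkHom` — at a point `x` of the special fibre with
  `dim 𝒪_{X,x} ≤ 1` of a smooth `R`-scheme with integral affine total space, `ϖ` is a uniformizer
  of the discrete valuation ring `𝒪_{X,x}`, `R → 𝒪_{X,x}` is local and `κ(x)` is separable over the
  residue field `k` of `R` (`SmoothSpecialFibrePoints`, `SmoothSpecialFibreResiduePoints`): the
  test rings "of ramification index `1`";
* `exists_nhds_extension_of_points` — **definedness in codimension `≤ 1` from the points
  property**: if every `L`-valued point of the separated, locally of finite type `R`-scheme
  `G` over `R` (`L = Frac S`, `S` a discrete valuation ring over `R` with uniformizer `ϖ`)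
  extends to an `S`-valued point, then an `R`-morphism `g : U → G` on an open `U ⊆ X`
  containing the generic fibre is defined at every `y` with `dim 𝒪_{X,y} ≤ 1`: the test point
  `Spec K(X) → U → G` extends to `Spec 𝒪_{X,y} → G`, which spreads out to a neighbourhood of
  `y` (Mathlib `spread_out_of_isGermInjective'`) and agrees with `g` where both are defined
  (they agree near the generic point, Mathlib `spread_out_unique_of_isGermInjective'`, hence
  everywhere, the source being reduced and the target separated,
  Mathlib `ext_of_isDominant_of_isSeparated`); `exists_nhds_extension_of_separablePoints` — the
  same assuming the points property only for the test rings `S` whose residue field is separable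
  over `k` (the form needed when `k` is imperfect).

[folklore]; no named facts (D-0026).

## References

* S. Bosch, W. Lütkebohmert, M. Raynaud, *Néron Models*, Springer 1990, §3.6, Thm. 7.1/1.
  [BLRNeronModels1990] (Not held; numbers only.)
* M. Artin, *Néron Models*, in Cornell–Silverman (eds.), *Arithmetic Geometry*, Springer 1986,
  Prop. (1.3), Cor. (1.6) (pp. 215–216). [Artin1986NeronModels]
-/

noncomputable section

universe u

open CategoryTheory AlgebraicGeometry IsLocalRing
open Literature.NumberTheory.EllipticCurves

namespace Literature.AlgebraicGeometry.Smoothening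

variable {R : Type u} [CommRing R] [IsDomain R] [IsDiscreteValuationRing R] {K : Type u} [Field K]
  [Algebra R K] [IsFractionRing R K]

/-! ### The `R`-algebra structure of the stalks of an `R`-scheme with affine total space -/

section Stalk

variable {𝒳 : Over (Spec (.of R))} [IsAffine 𝒳.left]

/-- The ring map `R → Γ(X, 𝒪_X)` of an `R`-scheme `X`. [folklore] -/
def globalHom (𝒳 : Over (Spec (.of R))) : R →+* Γ(𝒳.left, ⊤) :=
  𝒳.hom.appTop.hom.comp (Scheme.ΓSpecIso (.of R)).inv.hom

/-- The ring map `R → 𝒪_{X,x}` of an `R`-scheme `X` at a point `x`. [folklore] -/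
def stalkHom (𝒳 : Over (Spec (.of R))) (x : 𝒳.left) : R →+* 𝒳.left.presheaf.stalk x :=
  (𝒳.left.presheaf.germ ⊤ x trivial).hom.comp (globalHom 𝒳)

omit [IsDomain R] [IsDiscreteValuationRing R] in
/-- `X → Spec R` read through `X.toSpecΓ`. [folklore] -/
theorem hom_eq_toSpecΓ (𝒳 : Over (Spec (.of R))) :
    𝒳.hom = 𝒳.left.toSpecΓ ≫ Spec.map (CommRingCat.ofHom (globalHom 𝒳)) := by
  have h := Scheme.toSpecΓ_naturality 𝒳.hom
  have h2 : (Spec (.of R)).toSpecΓ ≫ Spec.map (Scheme.ΓSpecIso (.of R)).inv = 𝟙 _ :=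
    toSpecΓ_SpecMap_ΓSpecIso_inv (.of R)
  calc 𝒳.hom = 𝒳.hom ≫ (Spec (.of R)).toSpecΓ ≫ Spec.map (Scheme.ΓSpecIso (.of R)).inv := by
        rw [h2, Category.comp_id]
    _ = 𝒳.left.toSpecΓ ≫ Spec.map 𝒳.hom.appTop ≫ Spec.map (Scheme.ΓSpecIso (.of R)).inv := by
        rw [← Category.assoc, h, Category.assoc]
    _ = _ := by rw [← Spec.map_comp]; rfl

omit [IsDomain R] [IsDiscreteValuationRing R] [IsAffine 𝒳.left] in
/-- `Spec 𝒪_{X,x} → X → Spec R` is `Spec` of `R → Γ(X) → 𝒪_{X,x}`. [folklore] -/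
theorem fromSpecStalk_comp_hom (x : 𝒳.left) :
    𝒳.left.fromSpecStalk x ≫ 𝒳.hom = Spec.map (CommRingCat.ofHom (stalkHom 𝒳 x)) := by
  rw [hom_eq_toSpecΓ 𝒳, Scheme.fromSpecStalk_toSpecΓ_assoc, ← Spec.map_comp]
  rfl

end Stalk

/-! ### `ϖ` is a uniformizer of the local rings at codimension-one points of the special fibre -/

section Uniformizer

variable {ϖ : R} (hϖ : Irreducible ϖ) {𝒳 : Over (Spec (.of R))} [IsAffine 𝒳.left]
  [IsIntegral 𝒳.left] [Smooth 𝒳.hom]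

omit [IsDomain R] [IsDiscreteValuationRing R] [IsIntegral 𝒳.left] in
/-- `Γ(X, 𝒪_X)` is a smooth `R`-algebra for `X → Spec R` smooth with affine `X`. [folklore] -/
theorem smooth_globalHom : (globalHom 𝒳).Smooth := by
  have h := (HasRingHomProperty.iff_of_isAffine (P := @Smooth) (f := 𝒳.hom)).mp ‹_›
  exact RingHom.Smooth.comp
    (RingHom.Smooth.of_bijective (Scheme.ΓSpecIso (.of R)).commRingCatIsoToRingEquiv.symm.bijective) h

include hϖ in
omit [IsIntegral 𝒳.left] [Smooth 𝒳.hom] [IsAffine 𝒳.left] in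
/-- The preimage of the generic point `Spec K → Spec R` is the basic open `X_ϖ`. [folklore] -/
theorem preimage_range_specGenericPoint_eq :
    𝒳.hom.base ⁻¹' Set.range (specGenericPoint R K).base =
      (𝒳.left.basicOpen (globalHom 𝒳 ϖ) : Set 𝒳.left) := by
  haveI := Literature.AlgebraicGeometry.Motives.ZariskiChow.isLocalizationAway_of_irreducible R K hϖ
  have hrange : Set.range (specGenericPoint R K).base =
      ((PrimeSpectrum.basicOpen ϖ : TopologicalSpace.Opens (PrimeSpectrum R)) : Set (PrimeSpectrum R)) := by
    change Set.range (PrimeSpectrum.comap (algebraMap R K)) = _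
    exact PrimeSpectrum.localization_away_comap_range K ϖ
  have hpre : 𝒳.hom ⁻¹ᵁ (Spec (.of R)).basicOpen ((Scheme.ΓSpecIso (.of R)).inv ϖ) =
      𝒳.left.basicOpen (globalHom 𝒳 ϖ) := Scheme.preimage_basicOpen 𝒳.hom _
  have hpre' : 𝒳.hom.base ⁻¹' ((Spec (.of R)).basicOpen ((Scheme.ΓSpecIso (.of R)).inv ϖ) : Set _) =
      (𝒳.left.basicOpen (globalHom 𝒳 ϖ) : Set 𝒳.left) :=
    congrArg (fun V : 𝒳.left.Opens => (V : Set 𝒳.left)) hpre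
  refine Eq.trans ?_ hpre'
  congr 1
  rw [basicOpen_eq_of_affine]
  exact hrange

include hϖ in
/-- **At a point `x` of the special fibre with `dim 𝒪_{X,x} ≤ 1`, `𝒪_{X,x}` is a test ring of
ramification index `1`**: `ϖ` is a uniformizer of the discrete valuation ring `𝒪_{X,x}`,
`R → 𝒪_{X,x}` is a local homomorphism, and the residue field `κ(x)` is separable (formally smooth)
over the residue field of `R` (`X → Spec R` smooth, `X` integral affine): `𝒪_{X,x}` is the
localisation of the smooth `R`-domain `Γ(X)` at a minimal prime of `(ϖ)`
(`SmoothSpecialFibrePoints`, `SmoothSpecialFibreResiduePoints`). [folklore] -/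
theorem index_one_stalkHom {U : 𝒳.left.Opens}
    (hU : 𝒳.hom.base ⁻¹' Set.range (specGenericPoint R K).base ⊆ (U : Set 𝒳.left))
    {x : 𝒳.left} (hxU : x ∉ U) (hx : ringKrullDim (𝒳.left.presheaf.stalk x) ≤ 1) :
    Irreducible (stalkHom 𝒳 x ϖ) ∧ ∃ _ : IsLocalHom (stalkHom 𝒳 x),
      (ResidueField.map (stalkHom 𝒳 x)).FormallySmooth := by
  classical
  let A : Type u := Γ(𝒳.left, ⊤)
  letI : Algebra R A := (globalHom 𝒳).toAlgebra
  haveI : Algebra.Smooth R A := RingHom.smooth_algebraMap.mp (smooth_globalHom (𝒳 := 𝒳))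
  let S : Type u := 𝒳.left.presheaf.stalk x
  have htop : IsAffineOpen (⊤ : 𝒳.left.Opens) := isAffineOpen_top 𝒳.left
  letI algAS : Algebra A S :=
    TopCat.Presheaf.algebra_section_stalk 𝒳.left.presheaf (⟨x, trivial⟩ : (⊤ : 𝒳.left.Opens))
  letI algRS : Algebra R S := (stalkHom 𝒳 x).toAlgebra
  haveI : IsScalarTower R A S := IsScalarTower.of_algebraMap_eq fun r => rfl
  let P : Ideal A := (htop.primeIdealOf ⟨x, trivial⟩).asIdeal
  haveI hloc : IsLocalization.AtPrime S P := htop.isLocalization_stalk ⟨x, trivial⟩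
  haveI : Ring.KrullDimLE 1 S := (Order.krullDimLE_iff 1 (PrimeSpectrum S)).mpr hx
  -- `x` lies in the special fibre: `ϖ` is not a unit at `x`
  have hxϖ : x ∉ 𝒳.left.basicOpen (globalHom 𝒳 ϖ) := fun h =>
    hxU (hU (by rw [preimage_range_specGenericPoint_eq (K := K) hϖ]; exact h))
  have hϖP : algebraMap R A ϖ ∈ P := by
    have h1 : ¬ IsUnit (algebraMap A S (globalHom 𝒳 ϖ)) := by
      rwa [Scheme.mem_basicOpen_top] at hxϖ
    have h2 := (IsLocalization.AtPrime.isUnit_to_map_iff S P (globalHom 𝒳 ϖ)).not.mp h1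
    change globalHom 𝒳 ϖ ∈ P
    simpa [Ideal.primeCompl] using h2
  -- `ϖ ≠ 0` on `X`: the generic point lies in `X_ϖ`
  have hϖ0 : algebraMap R A ϖ ≠ 0 := by
    intro h0
    have hη : genericPoint 𝒳.left ∈ 𝒳.left.basicOpen (globalHom 𝒳 ϖ) := by
      rw [← SetLike.mem_coe, ← preimage_range_specGenericPoint_eq (K := K) hϖ, Set.mem_preimage,
        apply_genericPoint_eq]
      exact genericPoint_mem_range_specGenericPoint
    change globalHom 𝒳 ϖ = 0 at h0
    rw [h0, Scheme.basicOpen_zero] at hη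
    exact hη
  have hP := mem_minimalPrimes_of_krullDimLE_one P S hϖP hϖ0
  refine ⟨irreducible_algebraMap_of_isLocalization_atPrime hϖ P hP S hϖ0,
    isLocalHom_algebraMap_of_isLocalization_atPrime hϖ P hP S, ?_⟩
  exact formallySmooth_residueFieldMap_of_isLocalization_atPrime hϖ P hP S


include hϖ in
/-- **At a point `x` of the special fibre with `dim 𝒪_{X,x} ≤ 1`, `ϖ` is a uniformizer of the
discrete valuation ring `𝒪_{X,x}`** (`X → Spec R` smooth, `X` integral affine):
`𝒪_{X,x}` is the localisation of the smooth `R`-domain `Γ(X)` at a minimal prime of `(ϖ)`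
(`SmoothSpecialFibrePoints`). [folklore] -/
theorem irreducible_stalkHom {U : 𝒳.left.Opens}
    (hU : 𝒳.hom.base ⁻¹' Set.range (specGenericPoint R K).base ⊆ (U : Set 𝒳.left))
    {x : 𝒳.left} (hxU : x ∉ U) (hx : ringKrullDim (𝒳.left.presheaf.stalk x) ≤ 1) :
    Irreducible (stalkHom 𝒳 x ϖ) :=
  (index_one_stalkHom (K := K) hϖ hU hxU hx).1

end Uniformizer

/-! ### Definedness in codimension one from the points property -/

section Points

variable {ϖ : R} (hϖ : Irreducible ϖ) {𝒢 𝒳 : Over (Spec (.of R))}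

include hϖ in
/-- **Definedness in codimension `≤ 1` from the extension property for points with separable
residue field** (the test rings of ramification index `1`): Let `R` be a
discrete valuation ring with uniformizer `ϖ` and fraction field `K`, `G → Spec R` separated and
locally of finite type with the *points property*: for every discrete valuation ring `S` over `R`
in which `ϖ` is a uniformizer and whose residue field is separable over that of `R`, with
fraction field `L`, every `R`-morphism `Spec L → G` extends
to `Spec S → G`. Let `X → Spec R` be smooth with integral affine total space, `U ⊆ X` an open
containing the generic fibre and `g : U → G` an `R`-morphism. Then `g` is defined at every point
`y` with `dim 𝒪_{X,y} ≤ 1`: there are an open `V ∋ y` and `v : V → G` agreeing with `g` on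
`V ∩ U` — the hypothesis `h1` of Weil's extension theorem `weil_extension_of_codimOne`.
[cite: Artin1986NeronModels, Cor. (1.6) (pp. 215–216)] -/
theorem exists_nhds_extension_of_separablePoints [IsSeparated 𝒢.hom] [LocallyOfFiniteType 𝒢.hom]
    (hpts : ∀ (S : Type u) [CommRing S] [IsDomain S] [IsDiscreteValuationRing S] [Algebra R S]
      (L : Type u) [Field L] [Algebra S L] [IsFractionRing S L] [Algebra R L] [IsScalarTower R S L],
      Irreducible (algebraMap R S ϖ) →
        (∀ [IsLocalHom (algebraMap R S)], (ResidueField.map (algebraMap R S)).FormallySmooth) →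
        ∀ x : Spec (.of L) ⟶ 𝒢.left, x ≫ 𝒢.hom = Spec.map (CommRingCat.ofHom (algebraMap R L)) →
          ∃ x' : Spec (.of S) ⟶ 𝒢.left,
            Spec.map (CommRingCat.ofHom (algebraMap S L)) ≫ x' = x ∧
              x' ≫ 𝒢.hom = Spec.map (CommRingCat.ofHom (algebraMap R S)))
    [Smooth 𝒳.hom] [IsAffine 𝒳.left] [IsIntegral 𝒳.left] (U : 𝒳.left.Opens)
    (hU : 𝒳.hom.base ⁻¹' Set.range (specGenericPoint R K).base ⊆ (U : Set 𝒳.left))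
    (g : (U : Scheme.{u}) ⟶ 𝒢.left) (hg : g ≫ 𝒢.hom = U.ι ≫ 𝒳.hom) (y : 𝒳.left)
    (hy : ringKrullDim (𝒳.left.presheaf.stalk y) ≤ 1) :
    ∃ (V : 𝒳.left.Opens) (_ : y ∈ V) (v : (V : Scheme.{u}) ⟶ 𝒢.left),
      𝒳.left.homOfLE (inf_le_left : V ⊓ U ≤ V) ≫ v =
        𝒳.left.homOfLE (inf_le_right : V ⊓ U ≤ U) ≫ g := by
  classical
  by_cases hyU : y ∈ U
  · exact ⟨U, hyU, g, rfl⟩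
  -- the local ring at `y` is a discrete valuation ring with uniformizer `ϖ`
  have hη : genericPoint 𝒳.left ∈ U := genericPoint_mem_of_preimage_subset (K := K) hU
  have hyη : y ≠ genericPoint 𝒳.left := fun h => hyU (h ▸ hη)
  let S : Type u := 𝒳.left.presheaf.stalk y
  haveI : IsDiscreteValuationRing S := isDiscreteValuationRing_stalk_of_ringKrullDim_le_one (𝒳 := 𝒳) hyη hy
  letI algRS : Algebra R S := (stalkHom 𝒳 y).toAlgebra
  obtain ⟨hirr, hloc, hsep⟩ := index_one_stalkHom (K := K) hϖ hU hyU hy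
  -- the function field as an `R`-algebra through `𝒪_{X,y}`
  let L : Type u := 𝒳.left.functionField
  letI algRL : Algebra R L := ((algebraMap S L).comp (stalkHom 𝒳 y)).toAlgebra
  haveI : IsScalarTower R S L := IsScalarTower.of_algebraMap_eq fun r => rfl
  have hsp : genericPoint 𝒳.left ⤳ y := genericPoint_specializes y
  have halg : CommRingCat.ofHom (algebraMap S L) = 𝒳.left.presheaf.stalkSpecializes hsp := rfl
  -- the test point `Spec K(X) → U → G`
  let x : Spec (.of L) ⟶ 𝒢.left := U.fromSpecStalkOfMem (genericPoint 𝒳.left) hη ≫ g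
  have hx : x ≫ 𝒢.hom = Spec.map (CommRingCat.ofHom (algebraMap R L)) := by
    change (U.fromSpecStalkOfMem (genericPoint 𝒳.left) hη ≫ g) ≫ 𝒢.hom =
      Spec.map (CommRingCat.ofHom ((algebraMap S L).comp (stalkHom 𝒳 y)))
    rw [Category.assoc, hg, Scheme.Opens.fromSpecStalkOfMem_ι_assoc,
      ← Scheme.SpecMap_stalkSpecializes_fromSpecStalk_assoc hsp, fromSpecStalk_comp_hom,
      ← Spec.map_comp, ← halg]
    congr 1
  -- extend it to `Spec 𝒪_{X,y} → G`
  obtain ⟨x', hx'₁, hx'₂⟩ := hpts S L hirr hsep x hx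
  have hx'₂' : x' ≫ 𝒢.hom = 𝒳.left.fromSpecStalk y ≫ 𝒳.hom := by
    rw [hx'₂, fromSpecStalk_comp_hom]
  -- spread out to a neighbourhood `V` of `y`
  obtain ⟨V, hyV, v, hv₁, hv₂⟩ := spread_out_of_isGermInjective' 𝒳.hom 𝒢.hom x' hx'₂'
  refine ⟨V, hyV, v, ?_⟩
  -- the two morphisms `V ⊓ U → G` agree at the generic point …
  let W : 𝒳.left.Opens := V ⊓ U
  have hηV : genericPoint 𝒳.left ∈ V := hsp.mem_open V.2 hyV
  have hηW : genericPoint 𝒳.left ∈ W := ⟨hηV, hη⟩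
  let a : (W : Scheme.{u}) ⟶ 𝒢.left := 𝒳.left.homOfLE (inf_le_left : W ≤ V) ≫ v
  let b : (W : Scheme.{u}) ⟶ 𝒢.left := 𝒳.left.homOfLE (inf_le_right : W ≤ U) ≫ g
  change a = b
  haveI : IsIntegral (W : Scheme.{u}) := by
    haveI : Nonempty (W : Scheme.{u}) := ⟨⟨genericPoint 𝒳.left, hηW⟩⟩
    exact isIntegral_of_isOpenImmersion W.ι
  -- `Spec K(X) → V → G` is `x`: `V.fromSpecStalkOfMem η` factors through `Spec 𝒪_{X,y}`
  have eV : V.fromSpecStalkOfMem (genericPoint 𝒳.left) hηV =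
      Spec.map (𝒳.left.presheaf.stalkSpecializes hsp) ≫ V.fromSpecStalkOfMem y hyV := by
    rw [← cancel_mono V.ι, Category.assoc, Scheme.Opens.fromSpecStalkOfMem_ι,
      Scheme.Opens.fromSpecStalkOfMem_ι, Scheme.SpecMap_stalkSpecializes_fromSpecStalk]
  have hav : V.fromSpecStalkOfMem (genericPoint 𝒳.left) hηV ≫ v = x := by
    rw [eV, Category.assoc, ← hv₁, ← hx'₁, halg]
  -- restrictions from `W`
  have eWV : W.fromSpecStalkOfMem (genericPoint 𝒳.left) hηW ≫ 𝒳.left.homOfLE (inf_le_left : W ≤ V) =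
      V.fromSpecStalkOfMem (genericPoint 𝒳.left) hηV := by
    rw [← cancel_mono V.ι, Category.assoc, Scheme.homOfLE_ι, Scheme.Opens.fromSpecStalkOfMem_ι,
      Scheme.Opens.fromSpecStalkOfMem_ι]
  have eWU : W.fromSpecStalkOfMem (genericPoint 𝒳.left) hηW ≫ 𝒳.left.homOfLE (inf_le_right : W ≤ U) =
      U.fromSpecStalkOfMem (genericPoint 𝒳.left) hη := by
    rw [← cancel_mono U.ι, Category.assoc, Scheme.homOfLE_ι, Scheme.Opens.fromSpecStalkOfMem_ι,
      Scheme.Opens.fromSpecStalkOfMem_ι]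
  have habη : W.fromSpecStalkOfMem (genericPoint 𝒳.left) hηW ≫ a =
      W.fromSpecStalkOfMem (genericPoint 𝒳.left) hηW ≫ b := by
    change W.fromSpecStalkOfMem _ hηW ≫ 𝒳.left.homOfLE _ ≫ v = W.fromSpecStalkOfMem _ hηW ≫ 𝒳.left.homOfLE _ ≫ g
    rw [← Category.assoc, eWV, hav, ← Category.assoc, eWU]
  have hgenW : (W : Scheme.{u}).fromSpecStalk (⟨genericPoint 𝒳.left, hηW⟩ : (W : Scheme.{u})) ≫ a =
      (W : Scheme.{u}).fromSpecStalk (⟨genericPoint 𝒳.left, hηW⟩ : (W : Scheme.{u})) ≫ b := by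
    have e0 : (W : Scheme.{u}).fromSpecStalk (⟨genericPoint 𝒳.left, hηW⟩ : (W : Scheme.{u})) =
        Spec.map (W.ι.stalkMap ⟨genericPoint 𝒳.left, hηW⟩) ≫
          W.fromSpecStalkOfMem (genericPoint 𝒳.left) hηW := by
      simp [W, Scheme.Opens.fromSpecStalkOfMem]
    rw [e0, Category.assoc, Category.assoc]
    congr 1
  -- … hence on a neighbourhood of it, hence everywhere (reduced source, separated target)
  obtain ⟨W', hηW', hW'⟩ := spread_out_unique_of_isGermInjective' a b hgenW
  haveI : IsDominant W'.ι := by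
    refine ⟨?_⟩
    change Dense (Set.range W'.ι.base)
    rw [Scheme.Opens.range_ι]
    exact W'.2.dense ⟨_, hηW'⟩
  have hab : a ≫ 𝒢.hom = b ≫ 𝒢.hom := by
    change (𝒳.left.homOfLE _ ≫ v) ≫ 𝒢.hom = (𝒳.left.homOfLE _ ≫ g) ≫ 𝒢.hom
    rw [Category.assoc, Category.assoc, hv₂, hg, Scheme.homOfLE_ι_assoc, Scheme.homOfLE_ι_assoc]
  exact ext_of_isDominant_of_isSeparated 𝒢.hom hab W'.ι hW'

include hϖ in
/-- **Definedness in codimension `≤ 1` from the extension property for points.** Let `R` be a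
discrete valuation ring with uniformizer `ϖ` and fraction field `K`, `G → Spec R` separated and
locally of finite type with the *points property*: for every discrete valuation ring `S` over `R`
in which `ϖ` is a uniformizer, with fraction field `L`, every `R`-morphism `Spec L → G` extends
to `Spec S → G`. Let `X → Spec R` be smooth with integral affine total space, `U ⊆ X` an open
containing the generic fibre and `g : U → G` an `R`-morphism. Then `g` is defined at every point
`y` with `dim 𝒪_{X,y} ≤ 1`: there are an open `V ∋ y` and `v : V → G` agreeing with `g` on
`V ∩ U` — the hypothesis `h1` of Weil's extension theorem `weil_extension_of_codimOne`.
[cite: Artin1986NeronModels, Cor. (1.6) (pp. 215–216)] -/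
theorem exists_nhds_extension_of_points [IsSeparated 𝒢.hom] [LocallyOfFiniteType 𝒢.hom]
    (hpts : ∀ (S : Type u) [CommRing S] [IsDomain S] [IsDiscreteValuationRing S] [Algebra R S]
      (L : Type u) [Field L] [Algebra S L] [IsFractionRing S L] [Algebra R L] [IsScalarTower R S L],
      Irreducible (algebraMap R S ϖ) →
        ∀ x : Spec (.of L) ⟶ 𝒢.left, x ≫ 𝒢.hom = Spec.map (CommRingCat.ofHom (algebraMap R L)) →
          ∃ x' : Spec (.of S) ⟶ 𝒢.left,
            Spec.map (CommRingCat.ofHom (algebraMap S L)) ≫ x' = x ∧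
              x' ≫ 𝒢.hom = Spec.map (CommRingCat.ofHom (algebraMap R S)))
    [Smooth 𝒳.hom] [IsAffine 𝒳.left] [IsIntegral 𝒳.left] (U : 𝒳.left.Opens)
    (hU : 𝒳.hom.base ⁻¹' Set.range (specGenericPoint R K).base ⊆ (U : Set 𝒳.left))
    (g : (U : Scheme.{u}) ⟶ 𝒢.left) (hg : g ≫ 𝒢.hom = U.ι ≫ 𝒳.hom) (y : 𝒳.left)
    (hy : ringKrullDim (𝒳.left.presheaf.stalk y) ≤ 1) :
    ∃ (V : 𝒳.left.Opens) (_ : y ∈ V) (v : (V : Scheme.{u}) ⟶ 𝒢.left),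
      𝒳.left.homOfLE (inf_le_left : V ⊓ U ≤ V) ≫ v =
        𝒳.left.homOfLE (inf_le_right : V ⊓ U ≤ U) ≫ g :=
  exists_nhds_extension_of_separablePoints (K := K) hϖ
    (fun S _ _ _ _ L _ _ _ _ _ hirr _ x hx => hpts S L hirr x hx) U hU g hg y hy

end Points

end Literature.AlgebraicGeometry.Smoothening

end
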